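import Summits.Ventures.PercRepro.RankLevelSetRuleQSliceIBP
import Summits.Ventures.PercRepro.RankLevelSetRuleQSliceMapBorder

/-!
# PercRepro — THE FIXED-q PROFILE OF `L − Φ` IS UNIMODAL: EVERY UNTRUNCATED SLICE IS PAID ON EVERY CELL OF EVERY FAMILY
(night-1, gen 22; dossier §34)

At a fixed cell `(q+k, q)` the untruncated lower bound `L(q, k, m) = Σ_{0<j<k} C(q+k−m, j)·S_j(q, m)` moves by the slice step
`L(q, k, m+1) − L(q, k, m) = C(q−m−1+k, k−1)·S_k(q, m) − S_1(q, m)` (g18). The sign of this increment is decided by the ratio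
`ρ_m = C(q−m−1+k, k−1)·S_k(q, m)/S_1(q, m)`, and THE RATIO IS ANTITONE IN `m`:
* **`sliceS_vc`** — the VARIANCE CONDITION `(q−i)·(S_{j+2}S_j − S_{j+1}²) ≤ S_j·S_{j+1}` at every `(q, i ≥ 1)`, `j ≥ 1`
  (summation by parts + the Chebyshev inequality + log-convexity: RankLevelSetRuleQSliceIBP, Band);
* `sliceS_vc_sum` — summed over `j = 1 … k−1`: `(q−i)·(S_{k+1}S_1 − S_2S_k) ≤ (k−1)·S_kS_1`;
* **`ratio_step`** — hence `C(q−m−2+k, k−1)·S_k(q, m+1)·S_1(q, m) ≤ C(q−m−1+k, k−1)·S_k(q, m)·S_1(q, m+1)` (`1 ≤ m`):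
  once the increment is negative it stays negative;
* **`phiK_le_sliceL_of_untrunc`** — so `L(q, k, m) ≥ min(L(q, k, 0), L(q, k, q−k+1)) = Φ` on the whole untruncated range:
  the left end is `L(q, k, 0) = Φ`, the right end the first untruncated slice (every cell, `first_untrunc_slice_every`);
* **`untrunc_slice_every`** — `Φ(q+k, q) ≤ R̂(q, k, q−u)` for EVERY `u ≥ k−1` and every `q ≥ u` (`k ≥ 5`);
* **`rhat_slice_iff_every_family`** — THE COMPLETE SLICE MAP OF RULE Q ON EVERY FAMILY `k ≥ 5`: a slice `u` is paid on every cell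
  iff `u ≤ 1 ∨ k − 2 ≤ u` (with g20's negative half); **`ruleQ_slice_iff_every_family`** — the same at the matroid level.
Axioms: standard.
-/

namespace PercRepro

open Finset

/-! ### §1 The variance condition -/

/-- **THE VARIANCE CONDITION** at `(q, i+1)`: `(q − (i+1))·(S_{j+3}S_{j+1} − S_{j+2}²) ≤ S_{j+1}·S_{j+2}` (degrees `j+1 ≥ 1`). -/
theorem sliceS_vc (q i j : ℕ) :
    ((q : ℚ) - (i + 1)) * (sliceS q (i + 1) (j + 3) * sliceS q (i + 1) (j + 1) - sliceS q (i + 1) (j + 2) ^ 2)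
      ≤ sliceS q (i + 1) (j + 1) * sliceS q (i + 1) (j + 2) := by
  have hA := sliceS_ibp q i (j + 1)
  have hB := sliceS_ibp q i (j + 2)
  have hP1 := sliceS_succ_m q i (j + 2)
  have hP2 := sliceS_succ_m q i (j + 3)
  have hC := sliceS_chebyshev q i (j + 1)
  have hL := sliceS_sq_le q (i + 1) (j + 1)
  rw [show j + 1 + 1 = j + 2 by ring, show j + 1 + 2 = j + 3 by ring, show j + 1 + 3 = j + 4 by ring] at hC
  rw [show j + 1 + 1 = j + 2 by ring, show j + 1 + 2 = j + 3 by ring] at hL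
  rw [show j + 1 + 1 = j + 2 by ring] at hA
  rw [show j + 2 + 1 = j + 3 by ring] at hP1 hB
  rw [show j + 3 + 1 = j + 4 by ring] at hP2
  set a := sliceS q (i + 1) (j + 1) with ha
  set b := sliceS q (i + 1) (j + 2) with hb
  set c := sliceS q (i + 1) (j + 3) with hc
  set p := sliceS q i (j + 2) with hp
  set r := sliceS q i (j + 3) with hr
  set s := sliceS q i (j + 4) with hs
  have h1 : ((j : ℚ) + 2) * (a - b) = ((q : ℚ) - (i + 1)) * b + 2 * ((i : ℚ) + 1) * r := by
    push_cast at hA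
    linear_combination hA + 2 * ((i : ℚ) + 1) * hP1
  have h2 : ((j : ℚ) + 3) * (b - c) = ((q : ℚ) - (i + 1)) * c + 2 * ((i : ℚ) + 1) * s := by
    push_cast at hB
    linear_combination hB + 2 * ((i : ℚ) + 1) * hP2
  have key : ((q : ℚ) - (i + 1)) * (c * a - b ^ 2)
      = a * b - ((j : ℚ) + 3) * a * c + ((j : ℚ) + 2) * b ^ 2 - 2 * ((i : ℚ) + 1) * (a * s - b * r) := by
    linear_combination b * h1 - a * h2
  have ha0 : 0 ≤ a := sliceS_nonneg _ _ _
  have hc0 : 0 ≤ c := sliceS_nonneg _ _ _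
  have hi0 : (0 : ℚ) ≤ 2 * ((i : ℚ) + 1) := by positivity
  have hj0 : (0 : ℚ) ≤ (j : ℚ) + 2 := by positivity
  have e1 := mul_le_mul_of_nonneg_left hL hj0
  have e2 := mul_nonneg hi0 (sub_nonneg.mpr hC)
  have e3 := mul_nonneg ha0 hc0
  nlinarith [key, e1, e2, e3]

/-- The variance condition summed over the degrees `1 … k`: `(q−i)·(S_{k+2}S_1 − S_2S_{k+1}) ≤ k·S_{k+1}·S_1` at `(q, i+1)`. -/
theorem sliceS_vc_sum (q i k : ℕ) :
    ((q : ℚ) - (i + 1)) * (sliceS q (i + 1) (k + 2) * sliceS q (i + 1) 1 - sliceS q (i + 1) 2 * sliceS q (i + 1) (k + 1))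
      ≤ (k : ℚ) * sliceS q (i + 1) (k + 1) * sliceS q (i + 1) 1 := by
  induction k with
  | zero => simp
  | succ k ih =>
    have hvc := sliceS_vc q i k
    rw [show k + 3 = k + 1 + 2 by ring, show k + 2 = k + 1 + 1 by ring] at hvc
    have hS1 := sliceS_nonneg q (i + 1) 1
    have hSk := sliceS_pos q (i + 1) (k + 1)
    have hSk1 := sliceS_nonneg q (i + 1) (k + 1 + 1)
    -- multiply: (ih) * S_{k+2} + (vc) * S_1, then divide by S_{k+1}
    have e1 := mul_le_mul_of_nonneg_right ih hSk1
    have e2 := mul_le_mul_of_nonneg_right hvc hS1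
    have key : ((q : ℚ) - (i + 1)) * (sliceS q (i + 1) (k + 1 + 2) * sliceS q (i + 1) 1
          - sliceS q (i + 1) 2 * sliceS q (i + 1) (k + 1 + 1)) * sliceS q (i + 1) (k + 1)
        ≤ ((k : ℚ) + 1) * sliceS q (i + 1) (k + 1 + 1) * sliceS q (i + 1) 1 * sliceS q (i + 1) (k + 1) := by
      nlinarith [e1, e2]
    push_cast
    exact le_of_mul_le_mul_right key hSk

/-! ### §2 The ratio is antitone: a negative increment stays negative -/

/-- **THE RATIO STEP** (`1 ≤ m`, `m + 2 ≤ q`, `2 ≤ k`):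
`C(q−(m+1)−1+k, k−1)·S_k(q, m+1)·S_1(q, m) ≤ C(q−m−1+k, k−1)·S_k(q, m)·S_1(q, m+1)`. -/
theorem ratio_step (q k m : ℕ) (hk : 2 ≤ k) (hm : 1 ≤ m) (hmq : m + 2 ≤ q) :
    ((q - (m + 1) - 1 + k).choose (k - 1) : ℚ) * sliceS q (m + 1) k * sliceS q m 1
      ≤ ((q - m - 1 + k).choose (k - 1) : ℚ) * sliceS q m k * sliceS q (m + 1) 1 := by
  obtain ⟨i, rfl⟩ : ∃ i, m = i + 1 := ⟨m - 1, by omega⟩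
  obtain ⟨K, rfl⟩ : ∃ K, k = K + 2 := ⟨k - 2, by omega⟩
  obtain ⟨n, hn⟩ : ∃ n, q = i + 1 + 2 + n := ⟨q - (i + 1 + 2), by omega⟩
  subst hn
  -- the binomials: C(n+K+2, K+1) and C(n+K+3, K+1), with C(n+K+2,K+1)·(n+K+3) = C(n+K+3,K+1)·(n+2)
  rw [show i + 1 + 2 + n - (i + 1 + 1) - 1 + (K + 2) = n + K + 2 by omega,
    show i + 1 + 2 + n - (i + 1) - 1 + (K + 2) = n + K + 3 by omega, show K + 2 - 1 = K + 1 by omega]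
  have hbin := Nat.choose_mul_succ_eq (n + K + 2) (K + 1)
  rw [show n + K + 2 + 1 - (K + 1) = n + 2 by omega, show n + K + 2 + 1 = n + K + 3 by ring] at hbin
  have hbinq : ((n + K + 2).choose (K + 1) : ℚ) * ((n : ℚ) + K + 3) = ((n + K + 3).choose (K + 1) : ℚ) * ((n : ℚ) + 2) := by
    exact_mod_cast hbin
  -- the (VC)-sum at (q, i+1) with k := K+1: (q−(i+1))(S_{K+3}S_1 − S_2S_{K+2}) ≤ (K+1) S_{K+2} S_1
  have hsum := sliceS_vc_sum (i + 1 + 2 + n) i (K + 1)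
  rw [show K + 1 + 2 = K + 3 by ring, show K + 1 + 1 = K + 2 by ring] at hsum
  have hu : ((i + 1 + 2 + n : ℕ) : ℚ) - (i + 1) = (n : ℚ) + 2 := by push_cast; ring
  rw [hu] at hsum
  -- Pascal at (q, i+1): S_j(q, i+2) = S_j(q, i+1) + S_{j+1}(q, i+1)
  have hPk := sliceS_succ_m (i + 1 + 2 + n) (i + 1) (K + 2)
  have hP1 := sliceS_succ_m (i + 1 + 2 + n) (i + 1) 1
  rw [show K + 2 + 1 = K + 3 by ring] at hPk
  rw [show (1 : ℕ) + 1 = 2 from rfl] at hP1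
  set S1 := sliceS (i + 1 + 2 + n) (i + 1) 1 with hS1
  set S2 := sliceS (i + 1 + 2 + n) (i + 1) 2 with hS2
  set Sk := sliceS (i + 1 + 2 + n) (i + 1) (K + 2) with hSk
  set Sk1 := sliceS (i + 1 + 2 + n) (i + 1) (K + 3) with hSk1
  have hS10 : 0 ≤ S1 := sliceS_nonneg _ _ _
  have hS20 : 0 ≤ S2 := sliceS_nonneg _ _ _
  have hSk0 : 0 ≤ Sk := sliceS_nonneg _ _ _
  have hSk10 : 0 ≤ Sk1 := sliceS_nonneg _ _ _
  rw [hPk, hP1]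
  have hA : (0 : ℚ) ≤ ((n + K + 2).choose (K + 1) : ℚ) := by positivity
  have hB : (0 : ℚ) ≤ ((n + K + 3).choose (K + 1) : ℚ) := by positivity
  have hpos : (0 : ℚ) < (n : ℚ) + K + 3 := by positivity
  have hM : ((n : ℚ) + 2) * ((Sk + Sk1) * S1) ≤ ((n : ℚ) + K + 3) * (Sk * (S1 + S2)) := by
    push_cast at hsum
    nlinarith [hsum, mul_nonneg hSk0 hS20, mul_nonneg hSk0 hS10]
  have e : ((n + K + 2).choose (K + 1) : ℚ) * (Sk + Sk1) * S1 * ((n : ℚ) + K + 3)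
      = ((n + K + 3).choose (K + 1) : ℚ) * (((n : ℚ) + 2) * ((Sk + Sk1) * S1)) := by
    linear_combination ((Sk + Sk1) * S1) * hbinq
  have hfin : ((n + K + 2).choose (K + 1) : ℚ) * (Sk + Sk1) * S1 * ((n : ℚ) + K + 3)
      ≤ ((n + K + 3).choose (K + 1) : ℚ) * Sk * (S1 + S2) * ((n : ℚ) + K + 3) := by
    rw [e]
    have := mul_le_mul_of_nonneg_left hM hB
    nlinarith [this]
  exact le_of_mul_le_mul_right hfin hpos

/-! ### §3 Unimodality: the untruncated profile is at least its two ends -/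

/-- The slice step in the `sliceS` spelling (`m + 1 ≤ q`, `1 ≤ k`):
`L(q, k, m+1) = L(q, k, m) + (C(q−m−1+k, k−1)·S_k(q, m) − S_1(q, m))`. -/
lemma sliceL_succ (q k m : ℕ) (hk : 1 ≤ k) (hm : m + 1 ≤ q) :
    ∑ j ∈ Finset.Ioo 0 k, ((q + k - (m + 1)).choose j : ℚ) * sliceS q (m + 1) j
      = ∑ j ∈ Finset.Ioo 0 k, ((q + k - m).choose j : ℚ) * sliceS q m j
        + (((q - m - 1 + k).choose (k - 1) : ℚ) * sliceS q m k - sliceS q m 1) := by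
  have h := rhatSliceL_step (q - m - 1) k m hk
  rw [show m + 1 + (q - m - 1) = q by omega] at h
  have h' : ∑ j ∈ Finset.Ioo 0 k, ((q + k - m).choose j : ℚ) * sliceS q m j
      - ∑ j ∈ Finset.Ioo 0 k, ((q + k - (m + 1)).choose j : ℚ) * sliceS q (m + 1) j
      = sliceS q m 1 - ((q - m - 1 + k).choose (k - 1) : ℚ) * sliceS q m k := h
  linarith [h']

/-- `L(q, k, 0) = Φ(q+k, q)` (`k − 1 ≤ q`, `1 ≤ k`). -/
lemma sliceL_zero (q k : ℕ) (hk : 1 ≤ k) (hq : k - 1 ≤ q) :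
    ∑ j ∈ Finset.Ioo 0 k, ((q + k - 0).choose j : ℚ) * sliceS q 0 j = phiK (q + k) q := by
  have h1 := rhatSliceL_le_rhat q k 0
  have h2 := rhat_le_sliceL_of_untrunc q k 0 (by omega)
  have h3 := rhat_zero_eq q k hk
  have h1' : ∑ j ∈ Finset.Ioo 0 k, ((q + k - 0).choose j : ℚ) * sliceS q 0 j ≤ rhat q k 0 := h1
  linarith [h1', h2, h3]

/-- **THE UNTRUNCATED PROFILE IS AT LEAST ITS ENDS**: for `k ≥ 5` and `m + (k − 1) ≤ q`, `Φ(q+k, q) ≤ L(q, k, m)`. -/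
theorem phiK_le_sliceL_untrunc (q k m : ℕ) (hk : 5 ≤ k) (hm : m + (k - 1) ≤ q) :
    phiK (q + k) q ≤ ∑ j ∈ Finset.Ioo 0 k, ((q + k - m).choose j : ℚ) * sliceS q m j := by
  -- notation: L i, ε i
  set L : ℕ → ℚ := fun i => ∑ j ∈ Finset.Ioo 0 k, ((q + k - i).choose j : ℚ) * sliceS q i j with hL
  set ε : ℕ → ℚ := fun i => ((q - i - 1 + k).choose (k - 1) : ℚ) * sliceS q i k - sliceS q i 1 with hε
  have hstep : ∀ i, i + 1 ≤ q → L (i + 1) = L i + ε i := fun i hi => by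
    simp only [hL, hε]; exact sliceL_succ q k i (by omega) hi
  have hL0 : L 0 = phiK (q + k) q := by simp only [hL]; exact sliceL_zero q k (by omega) (by omega)
  set M := q - (k - 1) with hM
  have hLM : phiK (q + k) q ≤ L M := by
    have h1 := first_untrunc_slice_every k q hk (by omega)
    have h2 := rhat_le_sliceL_of_untrunc q k (q - (k - 1)) (by omega)
    simp only [hL, hM]
    exact h1.trans h2
  -- ε 0 ≥ 0 when q ≥ k (the cell m = 1 is paid)
  have hε0 : k ≤ q → 0 ≤ ε 0 := fun hkq => by
    have h1 := rhatCell_one q k (by omega) (by omega)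
    have h2 := rhat_le_sliceL_of_untrunc q k 1 (by omega)
    have h3 := hstep 0 (by omega)
    have : phiK (q + k) q ≤ L 1 := by simp only [hL]; exact h1.trans h2
    linarith [hL0, h3, this]
  -- a negative increment stays negative
  have hneg : ∀ i, 1 ≤ i → i + 2 ≤ q → ε i < 0 → ε (i + 1) < 0 := fun i hi hiq hlt => by
    have hr := ratio_step q k i (by omega) hi hiq
    have hS1 := sliceS_pos q i 1
    have hS1' := sliceS_pos q (i + 1) 1
    have hSk' := sliceS_nonneg q (i + 1) k
    have hC' : (0 : ℚ) ≤ ((q - (i + 1) - 1 + k).choose (k - 1) : ℚ) := by positivity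
    simp only [hε] at hlt ⊢
    -- C₁ S_k(i) < S_1(i); so C₂ S_k(i+1) S_1(i) ≤ C₁ S_k(i) S_1(i+1) < S_1(i) S_1(i+1)
    have h1 : ((q - i - 1 + k).choose (k - 1) : ℚ) * sliceS q i k * sliceS q (i + 1) 1
        < sliceS q i 1 * sliceS q (i + 1) 1 := by nlinarith [hlt, hS1']
    have h2 : ((q - (i + 1) - 1 + k).choose (k - 1) : ℚ) * sliceS q (i + 1) k * sliceS q i 1
        < sliceS q i 1 * sliceS q (i + 1) 1 := lt_of_le_of_lt hr h1
    have h3 : ((q - (i + 1) - 1 + k).choose (k - 1) : ℚ) * sliceS q (i + 1) k < sliceS q (i + 1) 1 := by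
      by_contra hcon
      push Not at hcon
      have := mul_le_mul_of_nonneg_right hcon hS1.le
      linarith [this, h2]
    linarith [h3]
  -- upward: all increments below m nonnegative ⇒ L m ≥ L 0
  have hup : ∀ m', m' ≤ q → (∀ i, i < m' → 0 ≤ ε i) → L 0 ≤ L m' := by
    intro m' hm' hall
    induction m' with
    | zero => exact le_rfl
    | succ n ih =>
      rw [hstep n (by omega)]
      have := ih (by omega) (fun i hi => hall i (by omega))
      have := hall n (by omega)
      linarith
  -- downward: all increments from m on nonpositive ⇒ L m ≥ L M
  have hdown : ∀ d m', m' + d = M → (∀ i, m' ≤ i → i < M → ε i ≤ 0) → L M ≤ L m' := by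
    intro d
    induction d with
    | zero => intro m' hm' _; rw [show m' = M by omega]
    | succ d ih =>
      intro m' hm' hall
      have h1 := ih (m' + 1) (by omega) (fun i hi hiM => hall i (by omega) hiM)
      have h2 := hstep m' (by omega)
      have h3 := hall m' le_rfl (by omega)
      linarith
  -- the argument
  have hmM : m ≤ M := by omega
  show phiK (q + k) q ≤ L m
  by_cases hall : ∀ i, i < m → 0 ≤ ε i
  · have := hup m (by omega) hall
    linarith [hL0]
  · push Not at hall
    obtain ⟨i₀, hi₀m, hi₀⟩ := hall
    have hkq : k ≤ q := by omega
    have hi₀1 : 1 ≤ i₀ := by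
      by_contra h0
      have : i₀ = 0 := by omega
      subst this
      linarith [hε0 hkq]
    have hall' : ∀ i, i₀ ≤ i → i < M → ε i < 0 := by
      intro i hi hiM
      induction i, hi using Nat.le_induction with
      | base => exact hi₀
      | succ i hi ih =>
        exact hneg i (by omega) (by omega) (ih (by omega))
    have := hdown (M - m) m (by omega) (fun i hi hiM => (hall' i (by omega) hiM).le)
    linarith [hLM]

/-! ### §4 The complete positive half, and the complete map -/

/-- **EVERY UNTRUNCATED SLICE IS PAID ON EVERY CELL OF EVERY FAMILY `k ≥ 5`**: for `k − 1 ≤ u ≤ q`,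
`Φ(q+k, q) ≤ R̂(q, k, q − u)`. -/
theorem untrunc_slice_every (k u q : ℕ) (hk : 5 ≤ k) (hu : k - 1 ≤ u) (huq : u ≤ q) :
    phiK (q + k) q ≤ rhat q k (q - u) := by
  have h1 := phiK_le_sliceL_untrunc q k (q - u) hk (by omega)
  have h2 := rhatSliceL_le_rhat q k (q - u)
  have h2' : ∑ j ∈ Finset.Ioo 0 k, ((q + k - (q - u)).choose j : ℚ) * sliceS q (q - u) j ≤ rhat q k (q - u) := h2
  exact h1.trans h2'

/-- **THE COMPLETE SLICE MAP OF RULE Q ON EVERY FAMILY `k ≥ 5`** (arithmetic level): a slice `u` is paid on every cell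
`(q+k, q)`, `q ≥ u`, iff `u ≤ 1 ∨ k − 2 ≤ u`. -/
theorem rhat_slice_iff_every_family (k u : ℕ) (hk : 5 ≤ k) :
    (∀ q, u ≤ q → phiK (q + k) q ≤ rhat q k (q - u)) ↔ (u ≤ 1 ∨ k - 2 ≤ u) := by
  constructor
  · intro h
    have := rhat_slice_only_if k u hk h
    omega
  · intro h q hq
    rcases Nat.lt_or_ge u (k - 1) with hlt | hge
    · exact rhat_slice_of_le_one_or_border k u hk (by omega) q hq
    · exact untrunc_slice_every k u q hk hge hq

/-- **THE COMPLETE SLICE MAP AT THE MATROID LEVEL**: at the tight layer `#E = (q+k) + q` of every finite matroid, the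
members at distance `u` from the top are paid by Rule Q's equal split on every cell iff `u ≤ 1 ∨ k − 2 ≤ u` (`k ≥ 5`). -/
theorem ruleQ_slice_iff_every_family (k u : ℕ) (hk : 5 ≤ k) :
    (∀ (β : Type) (M : Matroid β) (hf : M.Finite) (q : ℕ), u ≤ q → M.E.ncard = (q + k) + q →
        ∀ Z ∈ cellMembers M (q + k) q, (flatPart M Z).ncard = q - u →
          phiK (q + k) q ≤ @ruleQRecv β M hf (q + k) q Z) ↔ (u ≤ 1 ∨ k - 2 ≤ u) := by
  constructor
  · intro h
    have := ruleQ_slice_only_if k u hk h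
    omega
  · intro h β M hf q hq hE Z hZ hP
    have h1 := (rhat_slice_iff_every_family k u hk).mpr h q hq
    have h2 := @rhat_le_ruleQRecv β M hf q k hE Z hZ
    rw [hP] at h2
    exact h1.trans h2

end PercRepro
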